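import Summits.Schanuel.Schanuel.Theorems.ZilberEacParamSurfaceRealRatio
import HarnessLib

/-!
# Polynomially parametrised base curves, LII: new unconditional members of `EC(3,2)` via the
# fibration principle (threefolds fibred over the surfaces of gens 19–21)

HONEST FRAMING.  Cell `pub-schanuel` (Zilber's Exponential-Algebraic Closedness, case ladder;
host summit Schanuel), seat 2, gen 21.  Bookkeeping, no new analysis: THEOREM F′ of gen 5
(`inter_expGraph_nonempty_of_unprojectedDense_proj`: an irreducible threefold `W ⊆ ℂ³ × ℂ³`
meeting `G³`, of dimension `3`, whose torus part is fibred in curves over a surface `V ⊆ ℂ² × ℂ²`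
with Zariski-dense exponential points, meets `Γ_exp`) applied to the capstones of this generation:
every such `W` whose base surface is in Mantova–Masser's case (dim-π-S-1-free) over an
equal-degree curve with real irrational leading ratio (`inter_expGraph_nonempty_of_fibred_over_realIrrational`),
or over any polynomial curve in a regime of the master capstone (`…_over_paramCurve_master₃`), meets
the graph of `exp` — unconditional members of the OPEN cell `EC(3,2)` (no rotundity / freeness
hypotheses).  `EC(3,2)` itself stays OPEN; Mantova–Masser's question is OPEN in general
(PLMS 2024 §1 p. 5); NOT Schanuel's conjecture (neither used nor implied; EAC ⇏ SC).
-/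

noncomputable section

open Filter Topology Set Complex MvPolynomial
open Literature.NumberTheory.Transcendental Literature.ModelTheory.Zilber
open Literature.ModelTheory.ExponentialFields

set_option linter.dupNamespace false

namespace Summit.Schanuel.Schanuel.Theorems

/-- **New members of `EC(3,2)`: threefolds fibred over a surface of the case whose base curve is
an equal-degree polynomial curve with real irrational leading ratio.** [cite: MantovaMasser2023,
§1 Further remarks, p. 5] (new) -/
theorem inter_expGraph_nonempty_of_fibred_over_realIrrational (g₀ g₁ : Polynomial ℂ)
    (hn : 2 ≤ g₀.natDegree) (heq : g₁.natDegree = g₀.natDegree)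
    (him : (g₁.leadingCoeff / g₀.leadingCoeff).im = 0)
    (hirrat : Irrational (g₁.leadingCoeff / g₀.leadingCoeff).re)
    {W : Set (Fin (2 + 1) ⊕ Fin (2 + 1) → ℂ)}
    (hW : IsIrreducibleClosed ℂ W) (hne : (W ∩ torusLocus ℂ (2 + 1)).Nonempty)
    (hdim : zariskiDim ℂ W = (2 + 1 : ℕ))
    (hfib : zariskiDim ℂ (matrixAct (dropLastMat 2) '' (W ∩ torusLocus ℂ (2 + 1))) = (2 : ℕ))
    (hmm : MMCaseDimPiOneFree (zeroLocus ℂ (vanishingIdeal ℂ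
      ((fun (w : Fin (2 + 1) ⊕ Fin (2 + 1) → ℂ) (t : Fin 2 ⊕ Fin 2) =>
        w (Sum.map Fin.castSucc Fin.castSucc t)) '' (W ∩ torusLocus ℂ (2 + 1))))))
    (hbase : zeroLocus ℂ (vanishingIdeal ℂ (projAdd '' (zeroLocus ℂ (vanishingIdeal ℂ
      ((fun (w : Fin (2 + 1) ⊕ Fin (2 + 1) → ℂ) (t : Fin 2 ⊕ Fin 2) =>
        w (Sum.map Fin.castSucc Fin.castSucc t)) '' (W ∩ torusLocus ℂ (2 + 1)))) ∩
        torusLocus ℂ 2))) = {x : Fin 2 → ℂ | ∃ t : ℂ, x 0 = g₀.eval t ∧ x 1 = g₁.eval t}) :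
    (W ∩ expGraph ℂ (2 + 1)).Nonempty :=
  inter_expGraph_nonempty_of_unprojectedDense_proj hW hne hdim hfib
    (unprojectedDense_of_mmCase_of_base_eq_realIrrational g₀ g₁ hn heq him hirrat hmm hbase)

/-- **New members of `EC(3,2)`: threefolds fibred over a surface of the case whose base curve is a
polynomial curve in a regime of the master capstone (third edition).** [cite: MantovaMasser2023,
§1 Further remarks, p. 5] (new) -/
theorem inter_expGraph_nonempty_of_fibred_over_paramCurve_master₃ (g₀ g₁ : Polynomial ℂ)
    (hd₀ : 2 ≤ g₀.natDegree) (hd₁ : 2 ≤ g₁.natDegree)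
    (h : (g₀.natDegree < g₁.natDegree ∧ (¬ g₀.natDegree ∣ g₁.natDegree ∨
        (g₁.leadingCoeff * (I / g₀.leadingCoeff) ^ (g₁.natDegree / g₀.natDegree)).re ≠ 0 ∨
        g₁.natDegree < (Polynomial.C (g₀.leadingCoeff ^ (g₁.natDegree / g₀.natDegree)) * g₁ -
            Polynomial.C g₁.leadingCoeff * g₀ ^ (g₁.natDegree / g₀.natDegree)).natDegree +
          g₀.natDegree)) ∨
      (g₁.natDegree < g₀.natDegree ∧ (¬ g₁.natDegree ∣ g₀.natDegree ∨
        (g₀.leadingCoeff * (I / g₁.leadingCoeff) ^ (g₀.natDegree / g₁.natDegree)).re ≠ 0 ∨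
        g₀.natDegree < (Polynomial.C (g₁.leadingCoeff ^ (g₀.natDegree / g₁.natDegree)) * g₀ -
            Polynomial.C g₀.leadingCoeff * g₁ ^ (g₀.natDegree / g₁.natDegree)).natDegree +
          g₁.natDegree)) ∨
      (g₁.natDegree = g₀.natDegree ∧ (g₁.leadingCoeff / g₀.leadingCoeff).im ≠ 0) ∨
      (g₁.natDegree = g₀.natDegree ∧ (g₁.leadingCoeff / g₀.leadingCoeff).im = 0 ∧
        Irrational (g₁.leadingCoeff / g₀.leadingCoeff).re) ∨
      (g₁.natDegree = g₀.natDegree ∧ ∃ p q u v : ℤ, p * u + q * v = 1 ∧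
        (p : ℂ) * g₀.leadingCoeff + (q : ℂ) * g₁.leadingCoeff = 0 ∧
        2 ≤ (Polynomial.C (p : ℂ) * g₀ + Polynomial.C (q : ℂ) * g₁).natDegree ∧
        (¬ (Polynomial.C (p : ℂ) * g₀ + Polynomial.C (q : ℂ) * g₁).natDegree ∣ g₀.natDegree ∨
          ((Polynomial.C (u : ℂ) * g₁ - Polynomial.C (v : ℂ) * g₀).leadingCoeff *
              (I / (Polynomial.C (p : ℂ) * g₀ + Polynomial.C (q : ℂ) * g₁).leadingCoeff) ^
                (g₀.natDegree / (Polynomial.C (p : ℂ) * g₀ + Polynomial.C (q : ℂ) * g₁).natDegree)).re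
            ≠ 0 ∨
          g₀.natDegree <
            (Polynomial.C ((Polynomial.C (p : ℂ) * g₀ + Polynomial.C (q : ℂ) * g₁).leadingCoeff ^
                  (g₀.natDegree / (Polynomial.C (p : ℂ) * g₀ + Polynomial.C (q : ℂ) * g₁).natDegree)) *
                (Polynomial.C (u : ℂ) * g₁ - Polynomial.C (v : ℂ) * g₀) -
              Polynomial.C (Polynomial.C (u : ℂ) * g₁ - Polynomial.C (v : ℂ) * g₀).leadingCoeff *
                (Polynomial.C (p : ℂ) * g₀ + Polynomial.C (q : ℂ) * g₁) ^
                  (g₀.natDegree / (Polynomial.C (p : ℂ) * g₀ + Polynomial.C (q : ℂ) * g₁).natDegree)).natDegree +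
            (Polynomial.C (p : ℂ) * g₀ + Polynomial.C (q : ℂ) * g₁).natDegree)))
    {W : Set (Fin (2 + 1) ⊕ Fin (2 + 1) → ℂ)}
    (hW : IsIrreducibleClosed ℂ W) (hne : (W ∩ torusLocus ℂ (2 + 1)).Nonempty)
    (hdim : zariskiDim ℂ W = (2 + 1 : ℕ))
    (hfib : zariskiDim ℂ (matrixAct (dropLastMat 2) '' (W ∩ torusLocus ℂ (2 + 1))) = (2 : ℕ))
    (hmm : MMCaseDimPiOneFree (zeroLocus ℂ (vanishingIdeal ℂ
      ((fun (w : Fin (2 + 1) ⊕ Fin (2 + 1) → ℂ) (t : Fin 2 ⊕ Fin 2) =>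
        w (Sum.map Fin.castSucc Fin.castSucc t)) '' (W ∩ torusLocus ℂ (2 + 1))))))
    (hbase : zeroLocus ℂ (vanishingIdeal ℂ (projAdd '' (zeroLocus ℂ (vanishingIdeal ℂ
      ((fun (w : Fin (2 + 1) ⊕ Fin (2 + 1) → ℂ) (t : Fin 2 ⊕ Fin 2) =>
        w (Sum.map Fin.castSucc Fin.castSucc t)) '' (W ∩ torusLocus ℂ (2 + 1)))) ∩
        torusLocus ℂ 2))) = {x : Fin 2 → ℂ | ∃ t : ℂ, x 0 = g₀.eval t ∧ x 1 = g₁.eval t}) :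
    (W ∩ expGraph ℂ (2 + 1)).Nonempty :=
  inter_expGraph_nonempty_of_unprojectedDense_proj hW hne hdim hfib
    (unprojectedDense_of_mmCase_of_base_eq_paramCurve_master₃ g₀ g₁ hd₀ hd₁ h hmm hbase)

end Summit.Schanuel.Schanuel.Theorems
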